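import Mathlib
import Summits.Ventures.DiscreteObjects.Mahler.SmallMeasureCensus
import Summits.Ventures.DiscreteObjects.Mahler.SchwarzPickCoeff

/-!
# Blaschke data of a monic integer polynomial (venture `DiscreteObjects`, target L)

Cell `pub-namedobj`, seat `pub-namedobj-mahler` (gen 7). Framing: lottery ticket; floor = certified
bounds/negative ranges.

Set-up for the nonreciprocal Mahler-measure bound `M(P) ≥ (1+√17)/4` (`NonreciprocalMeasureBound.lean`,
[McKee–Smyth, *Around the Unit Circle*, §12.2.1]):

* `exists_first_nonpalindromic_coeff` — integer side: for `P` monic with `P(0) = ε = ±1` and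
  `P.reverse ≠ ε P`, the first nonzero coefficient `a X^k` of `ε P - P.reverse` has `k ≥ 1` and
  `ε P = P.reverse · (1 + a X^k) + X^{k+1} R`;
* `exists_blaschke_data` — complex side: splitting the roots `S` of `P` into `S₁ = {‖α‖ ≤ 1}` and
  `S₂ = {‖α‖ > 1}` (both closed under conjugation, `roots_map_conj`), the Blaschke quotients
  `f = ε ∏_{S₁} (z-α)/(1-ᾱz)` and `g = ∏_{S₂} (1-ᾱz)/(z-α)` are holomorphic on the unit disc, bounded
  by `1` there (factorwise, `SchwarzPickCoeff`), satisfy `f · P* = ε P · g` (`P* = P.reverse`),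
  `‖g 0‖ = 1/M(P)` and `f 0 = g 0`.
-/

namespace Summit.Ventures.DiscreteObjects.Mahler

open Polynomial Complex Metric Set Filter Topology
open scoped ComplexConjugate

/-! ### Integer side: the first non-palindromic coefficient -/

/-- For `P` monic with `P(0) = ε`, `ε² = 1` and `P.reverse ≠ ε P`: the first nonzero coefficient
`a X^k` of `ε P - P.reverse` has `k ≥ 1`, and `ε P = P.reverse · (1 + a X^k) + X^{k+1} R`. -/
theorem exists_first_nonpalindromic_coeff {P : ℤ[X]} (hmonic : P.Monic) {ε : ℤ}
    (hε : P.coeff 0 = ε) (hε1 : ε * ε = 1) (hne : P.reverse ≠ C ε * P) :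
    ∃ (k : ℕ) (a : ℤ) (R : ℤ[X]), 1 ≤ k ∧ a ≠ 0 ∧
      C ε * P = P.reverse * (1 + C a * X ^ k) + X ^ (k + 1) * R := by
  set D : ℤ[X] := C ε * P - P.reverse with hD
  have hD0 : D ≠ 0 := fun h => hne (sub_eq_zero.mp h).symm
  have hDc0 : D.coeff 0 = 0 := by
    rw [hD, coeff_sub, coeff_C_mul, coeff_zero_reverse, hmonic.leadingCoeff, hε, hε1, sub_self]
  set k := D.natTrailingDegree with hk
  set a := D.trailingCoeff with ha
  have ha0 : a ≠ 0 := trailingCoeff_nonzero_iff_nonzero.mpr hD0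
  have hk1 : 1 ≤ k := by
    apply le_natTrailingDegree hD0
    intro m hm
    interval_cases m
    exact hDc0
  have hdvd : X ^ (k + 1) ∣ C ε * P - P.reverse * (1 + C a * X ^ k) := by
    rw [X_pow_dvd_iff]
    intro d hd
    have hrw : C ε * P - P.reverse * (1 + C a * X ^ k) = D - C a * (X ^ k * P.reverse) := by
      rw [hD]; ring
    rw [hrw, coeff_sub, coeff_C_mul, coeff_X_pow_mul']
    rcases Nat.lt_or_ge d k with hlt | hge
    · rw [if_neg (not_le.mpr hlt), coeff_eq_zero_of_lt_natTrailingDegree hlt]; ring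
    · have hdk : d = k := by omega
      subst hdk
      rw [if_pos le_rfl, Nat.sub_self, coeff_zero_reverse, hmonic.leadingCoeff, mul_one]
      change D.coeff D.natTrailingDegree - D.trailingCoeff = 0
      rw [trailingCoeff, sub_self]
  obtain ⟨R, hR⟩ := hdvd
  exact ⟨k, a, R, hk1, ha0, by rw [← hR]; ring⟩

/-! ### Multiset helpers -/

/-- Norms of multiset products compare factorwise. -/
theorem norm_multiset_prod_le {s : Multiset ℂ} {φ χ : ℂ → ℂ} (h : ∀ α ∈ s, ‖φ α‖ ≤ ‖χ α‖) :
    ‖(s.map φ).prod‖ ≤ ‖(s.map χ).prod‖ := by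
  induction s using Multiset.induction_on with
  | empty => simp
  | cons b t ih =>
    simp only [Multiset.map_cons, Multiset.prod_cons, norm_mul]
    have hb := h b (Multiset.mem_cons_self b t)
    have ht := ih (fun α hα => h α (Multiset.mem_cons_of_mem hα))
    exact mul_le_mul hb ht (norm_nonneg _) (norm_nonneg _)

/-- The norm of a multiset product over `ℂ` is the product of the norms. -/
theorem norm_multiset_prod_eq (s : Multiset ℂ) (φ : ℂ → ℂ) :
    ‖(s.map φ).prod‖ = (s.map fun α => ‖φ α‖).prod := by
  induction s using Multiset.induction_on with
  | empty => simp
  | cons b t ih => simp [ih]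

/-- A multiset product over `ℂ` with nonzero factors is nonzero. -/
theorem multiset_prod_ne_zero {s : Multiset ℂ} {φ : ℂ → ℂ} (h : ∀ α ∈ s, φ α ≠ 0) :
    (s.map φ).prod ≠ 0 := by
  rw [Ne, Multiset.prod_eq_zero_iff, Multiset.mem_map]
  rintro ⟨α, hα, h0⟩
  exact h α hα h0

/-- Evaluation of a product of linear factors. -/
theorem eval_multiset_prod_X_sub_C (s : Multiset ℂ) (z : ℂ) :
    ((s.map fun α => X - C α).prod).eval z = (s.map fun α => z - α).prod := by
  rw [eval_multiset_prod, Multiset.map_map]; congr 1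
  apply Multiset.map_congr rfl; intro α _; simp

/-- Evaluation of a product of reversed linear factors `1 - c X`. -/
theorem eval_multiset_prod_one_sub_C_mul_X (s : Multiset ℂ) (c : ℂ → ℂ) (z : ℂ) :
    ((s.map fun α => (1 : ℂ[X]) - C (c α) * X).prod).eval z = (s.map fun α => 1 - c α * z).prod := by
  rw [eval_multiset_prod, Multiset.map_map]; congr 1
  apply Multiset.map_congr rfl; intro α _; simp

/-- The reverse of a product of monic linear factors: `(∏ (X - α))* = ∏ (1 - α X)`. -/
theorem reverse_multiset_prod_X_sub_C (s : Multiset ℂ) :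
    ((s.map fun α => X - C α).prod).reverse = (s.map fun α => (1 : ℂ[X]) - C α * X).prod := by
  have h1 : (1 : ℂ[X]).reverse = 1 := by simpa using reverse_C (1 : ℂ)
  have hX : (X : ℂ[X]).reverse = 1 := by simpa [h1] using reverse_mul_X (1 : ℂ[X])
  induction s using Multiset.induction_on with
  | empty => simpa using h1
  | cons b t ih =>
    rw [Multiset.map_cons, Multiset.prod_cons, Multiset.map_cons, Multiset.prod_cons,
      reverse_mul_of_domain, ih]
    congr 1
    rw [sub_eq_add_neg, ← C_neg, reverse_add_C, natDegree_X, pow_one, hX, C_neg]; ring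


/-! ### Complex side: roots and Blaschke products -/

/-- The complex roots of an integer polynomial form a multiset closed under conjugation. -/
theorem roots_map_conj (P : ℤ[X]) :
    ((P.map (Int.castRingHom ℂ)).roots).map (starRingEnd ℂ) = (P.map (Int.castRingHom ℂ)).roots := by
  set Pc := P.map (Int.castRingHom ℂ) with hPc
  have h1 : Pc.map (starRingEnd ℂ) = Pc := by
    rw [hPc, Polynomial.map_map, RingHom.ext_int ((starRingEnd ℂ).comp (Int.castRingHom ℂ))
      (Int.castRingHom ℂ)]
  have h2 := roots_map_of_injective_of_card_eq_natDegree (p := Pc) (starRingEnd ℂ).injective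
    IsAlgClosed.card_roots_eq_natDegree
  rwa [h1] at h2

/-- Reverse commutes with the embedding `ℤ[X] → ℂ[X]`. -/
theorem reverse_map_intCast (P : ℤ[X]) :
    (P.map (Int.castRingHom ℂ)).reverse = P.reverse.map (Int.castRingHom ℂ) := by
  unfold reverse
  rw [reflect_map, natDegree_map_eq_of_injective (RingHom.injective_int _)]

/-- A filtered sub-multiset of the roots by a conjugation-invariant predicate is conjugation-closed. -/
theorem filter_roots_map_conj (P : ℤ[X]) (q : ℂ → Prop) [DecidablePred q]
    (hq : ∀ α, q (starRingEnd ℂ α) ↔ q α) :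
    (((P.map (Int.castRingHom ℂ)).roots).filter q).map (starRingEnd ℂ) =
      ((P.map (Int.castRingHom ℂ)).roots).filter q := by
  conv_rhs => rw [← roots_map_conj P]
  rw [Multiset.filter_map]
  congr 1
  apply Multiset.filter_congr
  intro α _
  exact (hq α).symm

/-- **Blaschke data of a monic integer polynomial with `P(0) = ε = ±1`.**  There are functions `f, g`
holomorphic on the unit disc, bounded by `1` there, with `f · P* = ε · P · g` on the disc
(`P* = P.reverse`), `‖g 0‖ = 1/M(P)` and `f 0 = g 0`.  (`f = ε ∏_{‖α‖≤1} (z-α)/(1-ᾱz)`,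
`g = ∏_{‖α‖>1} (1-ᾱz)/(z-α)` over the complex roots `α` of `P`.) -/
theorem exists_blaschke_data {P : ℤ[X]} (hmonic : P.Monic) {ε : ℤ} (hε : P.coeff 0 = ε)
    (hε1 : ε * ε = 1) :
    ∃ f g : ℂ → ℂ, DifferentiableOn ℂ f (ball 0 1) ∧ DifferentiableOn ℂ g (ball 0 1) ∧
      (∀ z ∈ ball (0 : ℂ) 1, ‖f z‖ ≤ 1) ∧ (∀ z ∈ ball (0 : ℂ) 1, ‖g z‖ ≤ 1) ∧
      (∀ z ∈ ball (0 : ℂ) 1, f z * (P.reverse.map (Int.castRingHom ℂ)).eval z =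
        (ε : ℂ) * (P.map (Int.castRingHom ℂ)).eval z * g z) ∧
      ‖g 0‖ = (intMahlerMeasure P)⁻¹ ∧ f 0 = g 0 := by
  classical
  set Pc := P.map (Int.castRingHom ℂ) with hPc
  have hPcm : Pc.Monic := hmonic.map _
  set S := Pc.roots with hSdef
  have hcard : Multiset.card S = Pc.natDegree := IsAlgClosed.card_roots_eq_natDegree
  have hprod : (S.map fun α => X - C α).prod = Pc :=
    prod_multiset_X_sub_C_of_monic_of_roots_card_eq hPcm hcard
  set S₁ := S.filter fun α => ‖α‖ ≤ 1 with hS₁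
  set S₂ := S.filter fun α => ¬ ‖α‖ ≤ 1 with hS₂
  have hS : S₁ + S₂ = S := Multiset.filter_add_not _ S
  have hS₁conj : S₁.map (starRingEnd ℂ) = S₁ :=
    filter_roots_map_conj P _ (fun α => by rw [Complex.norm_conj])
  have hS₂conj : S₂.map (starRingEnd ℂ) = S₂ :=
    filter_roots_map_conj P _ (fun α => by rw [Complex.norm_conj])
  have hmem₁ : ∀ α ∈ S₁, ‖α‖ ≤ 1 := fun α hα => (Multiset.mem_filter.mp hα).2
  have hmem₂ : ∀ α ∈ S₂, 1 ≤ ‖α‖ := fun α hα => (not_le.mp (Multiset.mem_filter.mp hα).2).le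
  have hmem₂' : ∀ α ∈ S₂, 1 < ‖α‖ := fun α hα => not_le.mp (Multiset.mem_filter.mp hα).2
  -- the four polynomials
  set A : ℂ[X] := (S₁.map fun α => X - C α).prod with hA
  set B : ℂ[X] := (S₂.map fun α => X - C α).prod with hB
  set Abar : ℂ[X] := (S₁.map fun α => (1 : ℂ[X]) - C (starRingEnd ℂ α) * X).prod with hAbar
  set Bbar : ℂ[X] := (S₂.map fun α => (1 : ℂ[X]) - C (starRingEnd ℂ α) * X).prod with hBbar
  have hPAB : Pc = A * B := by
    rw [← hprod, ← hS, Multiset.map_add, Multiset.prod_add]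
  have hconj_prod : ∀ T : Multiset ℂ, T.map (starRingEnd ℂ) = T →
      (T.map fun α => (1 : ℂ[X]) - C (starRingEnd ℂ α) * X).prod =
        (T.map fun α => (1 : ℂ[X]) - C α * X).prod := by
    intro T hT
    conv_rhs => rw [← hT, Multiset.map_map]
    rfl
  have hPrev : Pc.reverse = Abar * Bbar := by
    rw [← hprod, reverse_multiset_prod_X_sub_C, ← hS, Multiset.map_add, Multiset.prod_add,
      ← hconj_prod S₁ hS₁conj, ← hconj_prod S₂ hS₂conj]
  have hPrev' : P.reverse.map (Int.castRingHom ℂ) = Abar * Bbar := by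
    rw [← reverse_map_intCast, ← hPc, hPrev]
  -- evaluations
  have hAe : ∀ z, A.eval z = (S₁.map fun α => z - α).prod := fun z => eval_multiset_prod_X_sub_C S₁ z
  have hBe : ∀ z, B.eval z = (S₂.map fun α => z - α).prod := fun z => eval_multiset_prod_X_sub_C S₂ z
  have hAbe : ∀ z, Abar.eval z = (S₁.map fun α => 1 - starRingEnd ℂ α * z).prod := fun z =>
    eval_multiset_prod_one_sub_C_mul_X S₁ _ z
  have hBbe : ∀ z, Bbar.eval z = (S₂.map fun α => 1 - starRingEnd ℂ α * z).prod := fun z =>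
    eval_multiset_prod_one_sub_C_mul_X S₂ _ z
  -- nonvanishing on the disc
  have hAbar0 : ∀ z ∈ ball (0 : ℂ) 1, Abar.eval z ≠ 0 := by
    intro z hz
    rw [hAbe]
    apply multiset_prod_ne_zero
    intro α hα h0
    have h1 : starRingEnd ℂ α * z = 1 := (sub_eq_zero.mp h0).symm
    have h2 : ‖starRingEnd ℂ α * z‖ < 1 := by
      rw [norm_mul, Complex.norm_conj]
      have := hmem₁ α hα
      have hz' := mem_ball_zero_iff.mp hz
      calc ‖α‖ * ‖z‖ ≤ 1 * ‖z‖ := by gcongr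
        _ < 1 := by rw [one_mul]; exact hz'
    rw [h1, norm_one] at h2
    exact lt_irrefl _ h2
  have hB0 : ∀ z ∈ ball (0 : ℂ) 1, B.eval z ≠ 0 := by
    intro z hz
    rw [hBe]
    apply multiset_prod_ne_zero
    intro α hα h0
    have h1 : z = α := sub_eq_zero.mp h0
    have := hmem₂' α hα
    rw [← h1] at this
    exact absurd (mem_ball_zero_iff.mp hz) (not_lt.mpr this.le)
  -- the functions
  refine ⟨fun z => (ε : ℂ) * A.eval z / Abar.eval z, fun z => Bbar.eval z / B.eval z,
    ?_, ?_, ?_, ?_, ?_, ?_, ?_⟩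
  · -- differentiability of f
    apply DifferentiableOn.div _ _ hAbar0
    · exact ((Polynomial.differentiable A).const_mul _).differentiableOn
    · exact (Polynomial.differentiable Abar).differentiableOn
  · apply DifferentiableOn.div _ _ hB0
    · exact (Polynomial.differentiable Bbar).differentiableOn
    · exact (Polynomial.differentiable B).differentiableOn
  · -- bound for f
    intro z hz
    have hz' : ‖z‖ ≤ 1 := (mem_ball_zero_iff.mp hz).le
    have hεn : ‖(ε : ℂ)‖ = 1 := by
      have : ((ε : ℂ)) * (ε : ℂ) = 1 := by exact_mod_cast hε1
      have h := congrArg norm this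
      rw [norm_mul, norm_one] at h
      nlinarith [norm_nonneg (ε : ℂ)]
    rw [norm_div, norm_mul, hεn, one_mul]
    apply div_le_one_of_le₀ _ (norm_nonneg _)
    rw [hAe, hAbe]
    exact norm_multiset_prod_le fun α hα => norm_sub_le_norm_one_sub_conj_mul (hmem₁ α hα) hz'
  · -- bound for g
    intro z hz
    have hz' : ‖z‖ ≤ 1 := (mem_ball_zero_iff.mp hz).le
    rw [norm_div]
    apply div_le_one_of_le₀ _ (norm_nonneg _)
    rw [hBe, hBbe]
    exact norm_multiset_prod_le fun α hα => norm_one_sub_conj_mul_le_norm_sub (hmem₂ α hα) hz'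
  · -- the identity f · P* = ε P g
    intro z hz
    simp only
    rw [hPrev', hPAB, eval_mul, eval_mul]
    field_simp [hAbar0 z hz, hB0 z hz]
  · -- ‖g 0‖ = 1/M
    have hB0e : ‖B.eval 0‖ = (S₂.map fun α => ‖α‖).prod := by
      rw [hBe, norm_multiset_prod_eq]
      congr 1
      apply Multiset.map_congr rfl
      intro α _; simp
    have hBb0e : Bbar.eval 0 = 1 := by
      rw [hBbe]; simp
    have hM : intMahlerMeasure P = (S₂.map fun α => ‖α‖).prod := by
      unfold intMahlerMeasure
      rw [← hPc, mahlerMeasure_eq_leadingCoeff_mul_prod_roots, hPcm.leadingCoeff, norm_one, one_mul,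
        ← hSdef, ← hS, Multiset.map_add, Multiset.prod_add]
      have h1 : (S₁.map fun α => max 1 ‖α‖).prod = 1 := by
        apply Multiset.prod_eq_one
        intro x hx
        obtain ⟨α, hα, rfl⟩ := Multiset.mem_map.mp hx
        exact max_eq_left (hmem₁ α hα)
      have h2 : (S₂.map fun α => max 1 ‖α‖) = S₂.map fun α => ‖α‖ := by
        apply Multiset.map_congr rfl
        intro α hα
        exact max_eq_right (hmem₂ α hα)
      rw [h1, h2, one_mul]
    simp only
    rw [norm_div, hBb0e, norm_one, hB0e, hM, one_div]
  · -- f 0 = g 0, from the identity at 0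
    have hPc0 : Pc.eval 0 = (ε : ℂ) := by
      rw [← coeff_zero_eq_eval_zero, hPc, coeff_map, hε]; simp
    have hPr0 : (P.reverse.map (Int.castRingHom ℂ)).eval 0 = 1 := by
      rw [← coeff_zero_eq_eval_zero, coeff_map, coeff_zero_reverse, hmonic.leadingCoeff]; simp
    have hεε : ((ε : ℂ)) * (ε : ℂ) = 1 := by exact_mod_cast hε1
    have hAbar00 : Abar.eval 0 ≠ 0 := hAbar0 0 (mem_ball_self one_pos)
    have hB00 : B.eval 0 ≠ 0 := hB0 0 (mem_ball_self one_pos)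
    have hid : (ε : ℂ) * A.eval 0 / Abar.eval 0 * (P.reverse.map (Int.castRingHom ℂ)).eval 0 =
        (ε : ℂ) * Pc.eval 0 * (Bbar.eval 0 / B.eval 0) := by
      rw [hPrev', hPAB, eval_mul, eval_mul]
      field_simp
    rw [hPr0, mul_one, hPc0] at hid
    simp only
    rw [hid, hεε, one_mul]


end Summit.Ventures.DiscreteObjects.Mahler
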